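import Summits.CriticalPhenomena.PercolationContinuityZ3.Theorems.Transplant.SiteVdBHKTwoSet
import Summits.CriticalPhenomena.PercolationContinuityZ3.Theorems.Transplant.SiteCSHDefs
import HarnessLib

/-!
# SITE percolation: (K6)_site — covariance transfer across a relay SET
# (lane `prim-bschramm`, class C1a; site twin of `AGloc.covTransfer_relaySet` / `CSH.covTransfer_relaySet_edge`)

builds on p205010 (kernel theorem, internal audit signed; external expert review pending).

For a relay set `R`, an owner `x ∈ R`, observers `o`, `v`, vertex weights `q` and `g` monotone nonnegative on vertex sets
(`m = ∫ g(C_x) dμ_q`, `D = {v ↮ R} = {ω | ∀ t ∈ R, t ∉ C_v(ω)}`):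
  `μ(D ∩ {o ↔ v}) · (∫_{v ↔ R} g(C_x) − μ(v ↔ R)·m) ≤ μ(D) · (∫_{o ↔ R} g(C_x) − μ(o ↔ R)·m)`      (`siteCovTransfer_relaySet`),
i.e. `Cov(g(C_x), 1{o ↔ R}) ≥ μ(o ↔ v | v ↮ R)·Cov(g(C_x), 1{v ↔ R})` — the SET four-point transfer (K6) of the conditioned slack hierarchy,
block (B2), in SITE form; in site percolation a functional of the vertex cluster suffices (no edge clusters).  Proof verbatim from the bond
file: Harris on `{o ↔ R} ∪ {o ↔ v}` (`SiteGen.setIntegral_siteClusterFun_ge`) and the SITE two-set negative correlation given `{v} ↮ R`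
(`SiteBHK3.siteTwoSet_negCorrelation`, landed p209295) for `1{o ∈ C_v}` and `g(C_x)` read inside `C_R` (`siteCluster_biUnion_eq`).
Valid for every vertex-weight function `q`, hence world by world.
Support file (`--supports stmt-CriticalPhenomena-4575 --as helper`); no definitions, no named facts, no sorries.
[cite: VandenbergHaggstromKahn2005, Thm. 1.4 (p. 7) with Remark 1 after Thm. 1.2 (p. 5)] [cite: KozmaNitzan2024, Conj. 4 (p. 32)]
-/

noncomputable section

namespace Summit.CriticalPhenomena.PercolationContinuityZ3.Theorems.Transplant

namespace SiteCSH

open MeasureTheory Set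
open Literature.Probability.LatticeModels (prodBernoulli)
open Literature.Probability.Percolation
open Summit.CriticalPhenomena.PercolationContinuityZ3.Theorems.SiteTransplant (siteConn mem_siteConn)
open SiteGen (mem_siteConn_iff_mem_siteCluster siteConn_comm siteCluster_eq_of_mem isUpperSet_siteConn siteCluster_mono'
  setIntegral_siteClusterFun_ge)
open scoped Classical

/-! ### The cluster of `x ∈ R` read inside `C_R` -/

/-- An open path from an open vertex `x` runs inside the site cluster of `x`. [folklore] -/
theorem reachable_siteOpenGraph_siteCluster {V : Type*} (Γ : SimpleGraph V) {ω : Set V} {x y : V} (hx : x ∈ ω)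
    (h : (siteOpenGraph Γ ω).Reachable x y) : (siteOpenGraph Γ (siteCluster Γ ω x)).Reachable x y := by
  rw [SimpleGraph.reachable_iff_reflTransGen] at h
  induction h with
  | refl => exact SimpleGraph.Reachable.refl x
  | tail hab hbc ih =>
    have hb := (SimpleGraph.reachable_iff_reflTransGen _ _).2 hab
    have hadj := (siteOpenGraph_adj Γ ω _ _).1 hbc
    have hbC : _ ∈ siteCluster Γ ω x := ⟨hx, hadj.2.1, hb⟩
    have hcC : _ ∈ siteCluster Γ ω x := ⟨hx, hadj.2.2, hb.trans hbc.reachable⟩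
    exact ih.trans (SimpleGraph.Adj.reachable ((siteOpenGraph_adj Γ _ _ _).2 ⟨hadj.1, hbC, hcC⟩))

/-- **The site cluster of `x ∈ R` is read inside `C_R = ⋃_{t ∈ R} C_t`**: `C_x(C_R(ω)) = C_x(ω)` (site analogue of
`CovTauStarN.openEdgeCluster_biUnion_eq`). [folklore] -/
theorem siteCluster_biUnion_eq {V : Type*} (Γ : SimpleGraph V) (R : Set V) {x : V} (hx : x ∈ R) (ω : Set V) :
    siteCluster Γ (⋃ t ∈ R, siteCluster Γ ω t) x = siteCluster Γ ω x := by
  have hWω : (⋃ t ∈ R, siteCluster Γ ω t) ⊆ ω := iUnion₂_subset fun t _ y hy => hy.2.1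
  refine Subset.antisymm (siteCluster_mono' Γ x hWω) fun y hy => ?_
  obtain ⟨hxω, hyω, hr⟩ := hy
  have hCW : siteCluster Γ ω x ⊆ ⋃ t ∈ R, siteCluster Γ ω t :=
    subset_biUnion_of_mem (u := fun t => siteCluster Γ ω t) hx
  refine ⟨hCW ((mem_siteCluster_self_iff Γ ω x).2 hxω), hCW ⟨hxω, hyω, hr⟩, ?_⟩
  refine (reachable_siteOpenGraph_siteCluster Γ hxω hr).mono fun a b hab => ?_
  rw [siteOpenGraph_adj] at hab ⊢
  exact ⟨hab.1, hCW hab.2.1, hCW hab.2.2⟩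

/-! ### (K6)_site -/

variable {n : ℕ} {Γ : SimpleGraph (Fin n)}

/-- **(K6)_site — covariance transfer across a relay set.**  For `x ∈ R`, `g` monotone nonnegative on vertex sets, `m = ∫ g(C_x)`,
`D = {v ↮ R}`:  `μ(D ∩ {o ↔ v})·(∫_{v ↔ R} g(C_x) − μ(v ↔ R)·m) ≤ μ(D)·(∫_{o ↔ R} g(C_x) − μ(o ↔ R)·m)`
(Harris + SITE vdBHK Thm 1.4 with the vertex set `R`; verbatim `CSH.covTransfer_relaySet_edge`).
[cite: VandenbergHaggstromKahn2005, Thm. 1.4 (p. 7) with Remark 1 after Thm. 1.2 (p. 5)] -/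
theorem siteCovTransfer_relaySet (q : Fin n → unitInterval) (R : Finset (Fin n)) (o v x : Fin n) (hxR : x ∈ R)
    (g : Set (Fin n) → ℝ) (hg : ∀ S S' : Set (Fin n), S ⊆ S' → g S ≤ g S') (hg0 : ∀ C, 0 ≤ g C) :
    (prodBernoulli q).real ({ω : Set (Fin n) | ∀ t ∈ R, t ∉ siteCluster Γ ω v} ∩ siteConn Γ o v) *
        (∫ ω in (⋃ t ∈ R, siteConn Γ v t), g (siteCluster Γ ω x) ∂(prodBernoulli q) -
          (prodBernoulli q).real (⋃ t ∈ R, siteConn Γ v t) * ∫ ω, g (siteCluster Γ ω x) ∂(prodBernoulli q)) ≤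
      (prodBernoulli q).real {ω : Set (Fin n) | ∀ t ∈ R, t ∉ siteCluster Γ ω v} *
        (∫ ω in (⋃ t ∈ R, siteConn Γ o t), g (siteCluster Γ ω x) ∂(prodBernoulli q) -
          (prodBernoulli q).real (⋃ t ∈ R, siteConn Γ o t) * ∫ ω, g (siteCluster Γ ω x) ∂(prodBernoulli q)) := by
  set μ := prodBernoulli q with hμ
  set f : Set (Fin n) → ℝ := fun ω => g (siteCluster Γ ω x) with hf
  set m : ℝ := ∫ ω, f ω ∂μ with hm
  have hmeas : ∀ T : Set (Set (Fin n)), MeasurableSet T := fun _ => MeasurableSet.of_discrete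
  have hint : ∀ (k : Set (Fin n) → ℝ) (T : Set (Set (Fin n))), IntegrableOn k T μ :=
    fun k T => (Integrable.of_finite).integrableOn
  have hn := fun (T : Set (Set (Fin n))) => (measureReal_nonneg : 0 ≤ μ.real T)
  set D : Set (Set (Fin n)) := {ω | ∀ t ∈ R, t ∉ siteCluster Γ ω v} with hD
  set OT : Set (Set (Fin n)) := ⋃ t ∈ R, siteConn Γ o t with hOT
  set Ov : Set (Set (Fin n)) := siteConn Γ o v with hOv
  set Q : Set (Set (Fin n)) := ⋃ t ∈ R, siteConn Γ v t with hQ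
  set U : Set (Set (Fin n)) := OT ∪ Ov with hU
  -- (1) Harris on `U`
  have hupT : IsUpperSet OT := isUpperSet_iUnion₂ fun t _ => isUpperSet_siteConn Γ o t
  have hHarris : μ.real U * m ≤ ∫ ω in U, f ω ∂μ :=
    setIntegral_siteClusterFun_ge (Γ := Γ) q x g hg hg0 U (hupT.union (isUpperSet_siteConn Γ o v))
  -- (2) SITE two-set BHK: `g(C_x)` (increasing in `C_R`) and `{o ↔ v}` (increasing in `C_v`) are negatively correlated given `v ↮ R`
  set F : Set (Fin n) → ℝ := fun W => if o ∈ W then 1 else 0 with hF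
  have hFmono : Monotone F := by
    intro W W' h
    simp only [hF]
    by_cases ho : o ∈ W
    · rw [if_pos ho, if_pos (h ho)]
    · rw [if_neg ho]; split_ifs <;> norm_num
  have hGmono : Monotone (fun W : Set (Fin n) => g (siteCluster Γ W x)) := fun W W' h => hg _ _ (siteCluster_mono' Γ x h)
  have hDset : {ω : Set (Fin n) | ∀ s ∈ ({v} : Set (Fin n)), ∀ t ∈ (↑R : Set (Fin n)), t ∉ siteCluster Γ ω s} = D := by
    ext ω; simp [hD]
  have hFval : ∀ ω : Set (Fin n), F (⋃ s ∈ ({v} : Set (Fin n)), siteCluster Γ ω s) = Ov.indicator (1 : Set (Fin n) → ℝ) ω := by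
    intro ω
    rw [biUnion_singleton]
    have e : (o ∈ siteCluster Γ ω v) ↔ ω ∈ Ov := by
      rw [hOv, siteConn_comm Γ o v]; exact (mem_siteConn_iff_mem_siteCluster Γ v o ω).symm
    by_cases ho : ω ∈ Ov
    · rw [indicator_of_mem ho, Pi.one_apply, hF]; simp only; rw [if_pos (e.2 ho)]
    · rw [indicator_of_notMem ho, hF]; simp only; rw [if_neg (fun h => ho (e.1 h))]
  have hGval : ∀ ω : Set (Fin n), g (siteCluster Γ (⋃ t ∈ (↑R : Set (Fin n)), siteCluster Γ ω t) x) = f ω := fun ω => by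
    simp only [hf]; rw [siteCluster_biUnion_eq Γ (↑R : Set (Fin n)) (Finset.mem_coe.2 hxR)]
  have hBHK := SiteBHK3.siteTwoSet_negCorrelation (Γ := Γ) q ({v} : Set (Fin n)) (↑R : Set (Fin n)) F
    (fun W => g (siteCluster Γ W x)) hFmono hGmono
  simp only [hDset, hFval, hGval] at hBHK
  have hprod : ∫ ω in D, Ov.indicator (1 : Set (Fin n) → ℝ) ω * f ω ∂μ = ∫ ω in D ∩ Ov, f ω ∂μ := by
    have e : (fun ω => Ov.indicator (1 : Set (Fin n) → ℝ) ω * f ω) = Ov.indicator f := by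
      funext ω
      by_cases h : ω ∈ Ov
      · rw [indicator_of_mem h, indicator_of_mem h, Pi.one_apply, one_mul]
      · rw [indicator_of_notMem h, indicator_of_notMem h, zero_mul]
    rw [e, setIntegral_indicator (hmeas Ov)]
  have hind1 : ∫ ω in D, Ov.indicator (1 : Set (Fin n) → ℝ) ω ∂μ = μ.real (D ∩ Ov) := by
    rw [setIntegral_indicator (hmeas Ov)]
    rw [show (∫ ω in D ∩ Ov, (1 : Set (Fin n) → ℝ) ω ∂μ) = ∫ _ in D ∩ Ov, (1 : ℝ) ∂μ from rfl, setIntegral_const, smul_eq_mul,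
      mul_one]
  rw [hprod, hind1] at hBHK
  change μ.real D * ∫ ω in D ∩ Ov, f ω ∂μ ≤ μ.real (D ∩ Ov) * ∫ ω in D, f ω ∂μ at hBHK
  -- (3) `U = OT ⊔ (D ∩ Ov)`
  have hUdiff : U \ OT = D ∩ Ov := by
    ext ω
    simp only [hU, hOT, hOv, hD, mem_sdiff, mem_union, mem_iUnion, mem_inter_iff, exists_prop, not_exists, not_and,
      mem_setOf_eq]
    constructor
    · rintro ⟨h | h, hno⟩
      · obtain ⟨t, ht, h'⟩ := h; exact absurd h' (hno t ht)
      · refine ⟨fun t ht hvt => hno t ht ?_, h⟩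
        -- `v ∈ C_o` and `t ∈ C_v` give `t ∈ C_o`
        have hvo : v ∈ siteCluster Γ ω o := (mem_siteConn_iff_mem_siteCluster Γ o v ω).1 h
        rw [mem_siteConn_iff_mem_siteCluster, siteCluster_eq_of_mem Γ hvo]
        exact hvt
    · rintro ⟨hd, hov⟩
      refine ⟨Or.inr hov, fun t ht hot => hd t ht ?_⟩
      -- `v ∈ C_o` and `t ∈ C_o` give `t ∈ C_v`
      have hvo : v ∈ siteCluster Γ ω o := (mem_siteConn_iff_mem_siteCluster Γ o v ω).1 hov
      rw [← siteCluster_eq_of_mem Γ hvo]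
      exact (mem_siteConn_iff_mem_siteCluster Γ o t ω).1 hot
  have hUint : ∫ ω in U, f ω ∂μ = ∫ ω in OT, f ω ∂μ + ∫ ω in D ∩ Ov, f ω ∂μ := by
    rw [← integral_inter_add_sdiff (hmeas OT) (hint f U), inter_eq_right.2 subset_union_left, hUdiff]
  have hUμ : μ.real U = μ.real OT + μ.real (D ∩ Ov) := by
    rw [← measureReal_inter_add_sdiff (s := U) (h := measure_ne_top _ _) (hmeas OT), inter_eq_right.2 subset_union_left, hUdiff]
  -- (4) `D = Qᶜ`
  have hDQ : D = Qᶜ := by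
    ext ω
    simp only [hD, hQ, mem_setOf_eq, mem_compl_iff, mem_iUnion, exists_prop, not_exists, not_and]
    exact forall₂_congr fun t _ => by rw [mem_siteConn_iff_mem_siteCluster]
  have hDint : ∫ ω in D, f ω ∂μ = m - ∫ ω in Q, f ω ∂μ := by
    have := integral_add_compl (hmeas Q) (Integrable.of_finite (f := f) (μ := μ))
    rw [← hDQ] at this
    linarith
  have hDμ : μ.real D = 1 - μ.real Q := by
    have h1 : μ.real (univ : Set (Set (Fin n))) = μ.real (univ ∩ Q) + μ.real (univ \ Q) :=
      (measureReal_inter_add_sdiff (s := univ) (h := measure_ne_top _ _) (hmeas Q)).symm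
    rw [probReal_univ, univ_inter, ← compl_eq_univ_sdiff, ← hDQ] at h1
    linarith
  -- assemble
  have hA : ∫ ω in OT, f ω ∂μ - μ.real OT * m ≥ μ.real (D ∩ Ov) * m - ∫ ω in D ∩ Ov, f ω ∂μ := by
    rw [hUint, hUμ] at hHarris
    linarith
  have hB : μ.real D * (μ.real (D ∩ Ov) * m - ∫ ω in D ∩ Ov, f ω ∂μ) ≥
      μ.real D * (μ.real (D ∩ Ov) * m) - μ.real (D ∩ Ov) * ∫ ω in D, f ω ∂μ := by
    rw [mul_sub]
    linarith [hBHK]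
  have hC := mul_le_mul_of_nonneg_left hA (hn D)
  rw [hDint, hDμ] at hB
  rw [hDμ] at hC ⊢
  nlinarith [hB, hC, hn (D ∩ Ov), hn Q]

end SiteCSH

end Summit.CriticalPhenomena.PercolationContinuityZ3.Theorems.Transplant
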